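import Summits.AtomisticToContinuum.Crystallization.Theorems.ChargedEnergyGapTwinSectorA

/-!
# «TwinSector» (lens-3 g58 P-F, line 14231) — part B (sequel of `…ChargedEnergyGapTwinSectorA`)

Split for the 400-line cap by the landing lane (hand-2 g29); the module docstring of part A describes the whole node.  Same namespace; all FQNs unchanged.
0 sorry; standard axioms.
-/


open Matrix
open scoped RealInnerProductSpace

namespace Summit.AtomisticToContinuum.Crystallization.Theorems.ChargedEnergyGapChartDial

section TwinSector

variable {V : Type*} [NormedAddCommGroup V] [InnerProductSpace ℝ V]

/-! ### §4 The angular model: (CONSECUTIVE), and the distinctness inside (COPLANAR), are plane geometry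

The faces around `e` ARE half-planes at angles `θ 0 < θ 1 < ⋯ < θ (k−1) < θ 0 + 2π` in the plane `e^⊥ = span(e₁, e₂)` (`e₁, e₂`
orthonormal), face `j` pointing along `cos (θ j) • e₁ + sin (θ j) • e₂`.  In this model (CONSECUTIVE) is a THEOREM
(`consecutive_of_angular`: between two opposite consecutive faces lies a flat half-space, all other faces are in the complementary open
half-space) and distinct faces point in distinct directions (`dir_ne_of_lt`), so (COPLANAR) weakens to the pure incidence statement
(COLLINEAR) «two faces with the same reference normal are collinear half-planes, `u j = u i ∨ u j = -u i`» (two half-planes issuing from `e`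
inside the ONE crystallographic plane through `e` with that normal).  Net modelling input of junction exclusion (`length_eq_two_of_angular`):
ANGULAR ORDER + (COLLINEAR) + (CLOSED) — incidence only; no length, no angle value, no numeral. -/

/-- `⟪e₁, cos t • e₁ + sin t • e₂⟫ = cos t`. -/
theorem inner_e₁_dir {e₁ e₂ : V} (h₁ : ‖e₁‖ = 1) (h₁₂ : ⟪e₁, e₂⟫ = 0) (t : ℝ) :
    ⟪e₁, Real.cos t • e₁ + Real.sin t • e₂⟫ = Real.cos t := by
  rw [inner_add_right, real_inner_smul_right, real_inner_smul_right, real_inner_self_eq_norm_sq, h₁, h₁₂]; ring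

/-- `⟪e₂, cos t • e₁ + sin t • e₂⟫ = sin t`. -/
theorem inner_e₂_dir {e₁ e₂ : V} (h₂ : ‖e₂‖ = 1) (h₁₂ : ⟪e₁, e₂⟫ = 0) (t : ℝ) :
    ⟪e₂, Real.cos t • e₁ + Real.sin t • e₂⟫ = Real.sin t := by
  rw [inner_add_right, real_inner_smul_right, real_inner_smul_right, real_inner_self_eq_norm_sq, h₂, real_inner_comm e₁ e₂, h₁₂]
  ring

/-- The inward normal `m = sin s • e₁ - cos s • e₂` of the half-space to the RIGHT of the direction at angle `s`:
`⟪m, dir t⟫ = sin (s - t)`. -/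
theorem inner_perp_dir {e₁ e₂ : V} (h₁ : ‖e₁‖ = 1) (h₂ : ‖e₂‖ = 1) (h₁₂ : ⟪e₁, e₂⟫ = 0) (s t : ℝ) :
    ⟪Real.sin s • e₁ - Real.cos s • e₂, Real.cos t • e₁ + Real.sin t • e₂⟫ = Real.sin (s - t) := by
  rw [inner_sub_left, real_inner_smul_left, real_inner_smul_left, inner_add_right, inner_add_right,
    real_inner_smul_right, real_inner_smul_right, real_inner_smul_right, real_inner_smul_right,
    real_inner_self_eq_norm_sq, real_inner_self_eq_norm_sq, h₁, h₂, real_inner_comm e₁ e₂, h₁₂, Real.sin_sub]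
  ring

/-- Two directions less than one turn apart which are OPPOSITE differ by exactly `π`. -/
theorem angle_eq_add_pi_of_dir_eq_neg {e₁ e₂ : V} (h₁ : ‖e₁‖ = 1) (h₂ : ‖e₂‖ = 1) (h₁₂ : ⟪e₁, e₂⟫ = 0) {s t : ℝ}
    (hst : s < t) (hts : t < s + 2 * Real.pi)
    (h : Real.cos t • e₁ + Real.sin t • e₂ = -(Real.cos s • e₁ + Real.sin s • e₂)) : t = s + Real.pi := by
  have hc : Real.cos t = -Real.cos s := by
    simpa only [inner_neg_right, inner_e₁_dir h₁ h₁₂] using congrArg (fun v => ⟪e₁, v⟫) h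
  have hs : Real.sin t = -Real.sin s := by
    simpa only [inner_neg_right, inner_e₂_dir h₂ h₁₂] using congrArg (fun v => ⟪e₂, v⟫) h
  have h1 : Real.cos (t - s - Real.pi) = 1 := by
    rw [Real.cos_sub_pi, Real.cos_sub, hc, hs]
    linear_combination Real.cos_sq_add_sin_sq s
  have h2 : t - s - Real.pi = 0 :=
    (Real.cos_eq_one_iff_of_lt_of_lt (by linarith [Real.pi_pos]) (by linarith [Real.pi_pos])).1 h1
  linarith

/-- Two directions strictly between zero and one turn apart are DISTINCT (distinct faces point in distinct directions). -/
theorem dir_ne_of_lt {e₁ e₂ : V} (h₁ : ‖e₁‖ = 1) (h₂ : ‖e₂‖ = 1) (h₁₂ : ⟪e₁, e₂⟫ = 0) {s t : ℝ}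
    (hst : s < t) (hts : t < s + 2 * Real.pi) :
    Real.cos t • e₁ + Real.sin t • e₂ ≠ Real.cos s • e₁ + Real.sin s • e₂ := by
  intro h
  have hc : Real.cos t = Real.cos s := by
    simpa only [inner_e₁_dir h₁ h₁₂] using congrArg (fun v => ⟪e₁, v⟫) h
  have hs : Real.sin t = Real.sin s := by
    simpa only [inner_e₂_dir h₂ h₁₂] using congrArg (fun v => ⟪e₂, v⟫) h
  have h1 : Real.cos (t - s) = 1 := by
    rw [Real.cos_sub, hc, hs]
    linear_combination Real.cos_sq_add_sin_sq s
  have h2 : t - s = 0 := (Real.cos_eq_one_iff_of_lt_of_lt (by linarith [Real.pi_pos]) (by linarith)).1 h1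
  linarith

/-- ★ (CONSECUTIVE) IS A THEOREM OF THE ANGULAR MODEL.  Faces at angles `θ 0 < θ 1 < ⋯ < θ (k−1) < θ 0 + 2π` around `e`; if the
consecutive faces `i, i+1` are opposite half-planes then `θ (i+1) = θ i + π`, the grain between them is the flat half-space to their left,
and every other face lies in the OPEN half-space to their right: `0 < ⟪m, u l⟫` with `m = sin (θ i) • e₁ - cos (θ i) • e₂`. -/
theorem consecutive_of_angular {e₁ e₂ : V} (h₁ : ‖e₁‖ = 1) (h₂ : ‖e₂‖ = 1) (h₁₂ : ⟪e₁, e₂⟫ = 0) (k : ℕ) (θ : ℕ → ℝ)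
    (hmono : ∀ i j : ℕ, i < j → j < k → θ i < θ j) (hturn : ∀ j : ℕ, j < k → θ j < θ 0 + 2 * Real.pi)
    (u : ℕ → V) (hu : ∀ j, u j = Real.cos (θ j) • e₁ + Real.sin (θ j) • e₂) :
    ∀ i : ℕ, i + 1 < k → u (i + 1) = -u i → ∃ m : V, ∀ l : ℕ, l < k → l ≠ i → l ≠ i + 1 → 0 < ⟪m, u l⟫ := by
  have h0 : ∀ l, l < k → θ 0 ≤ θ l := fun l hl => by
    rcases Nat.eq_zero_or_pos l with rfl | hpos
    · exact le_rfl
    · exact (hmono 0 l hpos hl).le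
  intro i hi hopp
  have hik : i < k := Nat.lt_of_succ_lt hi
  rw [hu, hu] at hopp
  have hπ : θ (i + 1) = θ i + Real.pi :=
    angle_eq_add_pi_of_dir_eq_neg h₁ h₂ h₁₂ (hmono i (i + 1) (Nat.lt_succ_self i) hi)
      (by linarith [hturn (i + 1) hi, h0 i hik]) hopp
  refine ⟨Real.sin (θ i) • e₁ - Real.cos (θ i) • e₂, fun l hl hli hli1 => ?_⟩
  rw [hu, inner_perp_dir h₁ h₂ h₁₂]
  rcases Nat.lt_or_gt_of_ne hli with hlt | hgt
  · -- a face BEFORE `i`: `0 < θ i - θ l < π`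
    have ha : 0 < θ i - θ l := by linarith [hmono l i hlt hik]
    have hb : θ i - θ l < Real.pi := by linarith [hturn (i + 1) hi, h0 l hl]
    exact Real.sin_pos_of_pos_of_lt_pi ha hb
  · -- a face AFTER `i + 1`: `π < θ l - θ i < 2π`
    have hgt' : i + 1 < l := by omega
    have ha : θ i + Real.pi < θ l := by linarith [hmono (i + 1) l hgt' hl]
    have hb : θ l < θ i + 2 * Real.pi := by linarith [hturn l hl, h0 i hik]
    rw [← Real.sin_add_two_pi]
    exact Real.sin_pos_of_pos_of_lt_pi (by linarith) (by linarith)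

/-- ★★★ JUNCTION EXCLUSION IN THE ANGULAR MODEL: faces at angles `θ 0 < ⋯ < θ (k−1) < θ 0 + 2π` around the line; (COLLINEAR) two faces
with the same reference normal are collinear half-planes (`u j = ± u i`); (CLOSED) the orientation returns.  THEN `k = 2`. -/
theorem length_eq_two_of_angular {w : List (Fin 4)} (hw : w ≠ []) {e₁ e₂ : V} (h₁ : ‖e₁‖ = 1) (h₂ : ‖e₂‖ = 1)
    (h₁₂ : ⟪e₁, e₂⟫ = 0) (θ : ℕ → ℝ) (hmono : ∀ i j : ℕ, i < j → j < w.length → θ i < θ j)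
    (hturn : ∀ j : ℕ, j < w.length → θ j < θ 0 + 2 * Real.pi)
    (u : ℕ → V) (hu : ∀ j, u j = Real.cos (θ j) • e₁ + Real.sin (θ j) • e₂)
    (hcoll : ∀ i j : ℕ, i < w.length → j < w.length → i ≠ j → faceNormal w i = faceNormal w j → u j = u i ∨ u j = -u i)
    (hI : (w.map twinRot).prod ∈ integralMatrices) : w.length = 2 := by
  refine length_eq_two_of_sector hw u ?_ (consecutive_of_angular h₁ h₂ h₁₂ w.length θ hmono hturn u hu) hI
  have h0 : ∀ l, l < w.length → θ 0 ≤ θ l := fun l hl => by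
    rcases Nat.eq_zero_or_pos l with rfl | hpos
    · exact le_rfl
    · exact (hmono 0 l hpos hl).le
  intro i j hi hj hij hN
  rcases hcoll i j hi hj hij hN with h | h
  · exfalso
    rcases Nat.lt_or_gt_of_ne hij with hlt | hgt
    · have h' := h
      rw [hu, hu] at h'
      exact dir_ne_of_lt h₁ h₂ h₁₂ (hmono i j hlt hj) (by linarith [hturn j hj, h0 i hi]) h'
    · have h' := h.symm
      rw [hu, hu] at h'
      exact dir_ne_of_lt h₁ h₂ h₁₂ (hmono j i hgt hi) (by linarith [hturn i hi, h0 j hj]) h'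
  · exact h

/-- … and the sector structure: the word is `[a, a]`, the two faces are opposite, `θ 1 = θ 0 + π` — one complete coherent plane. -/
theorem sector_structure_of_angular {w : List (Fin 4)} (hw : w ≠ []) {e₁ e₂ : V} (h₁ : ‖e₁‖ = 1) (h₂ : ‖e₂‖ = 1)
    (h₁₂ : ⟪e₁, e₂⟫ = 0) (θ : ℕ → ℝ) (hmono : ∀ i j : ℕ, i < j → j < w.length → θ i < θ j)
    (hturn : ∀ j : ℕ, j < w.length → θ j < θ 0 + 2 * Real.pi)
    (u : ℕ → V) (hu : ∀ j, u j = Real.cos (θ j) • e₁ + Real.sin (θ j) • e₂)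
    (hcoll : ∀ i j : ℕ, i < w.length → j < w.length → i ≠ j → faceNormal w i = faceNormal w j → u j = u i ∨ u j = -u i)
    (hI : (w.map twinRot).prod ∈ integralMatrices) : ∃ a : Fin 4, w = [a, a] ∧ θ 1 = θ 0 + Real.pi := by
  have h2 := length_eq_two_of_angular hw h₁ h₂ h₁₂ θ hmono hturn u hu hcoll hI
  obtain ⟨i, hi, hii⟩ := exists_adjacent_eq_of_prod_mem hw hI
  have hi0 : i = 0 := by omega
  subst hi0
  have h01 : u 1 = u 0 ∨ u 1 = -u 0 := hcoll 0 1 (by omega) (by omega) zero_ne_one (faceNormal_eq_succ_of_getElem_eq hi hii)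
  have hlt : θ 0 < θ 1 := hmono 0 1 zero_lt_one (by omega)
  have hturn1 : θ 1 < θ 0 + 2 * Real.pi := hturn 1 (by omega)
  rcases h01 with h | h
  · rw [hu, hu] at h
    exact absurd h (dir_ne_of_lt h₁ h₂ h₁₂ hlt hturn1)
  · rw [hu, hu] at h
    obtain ⟨x, y, rfl⟩ := List.length_eq_two.1 h2
    have hxy : x = y := by simpa using hii
    exact ⟨x, by rw [hxy], angle_eq_add_pi_of_dir_eq_neg h₁ h₂ h₁₂ hlt hturn1 h⟩

/-- NON-VACUITY of the angular hypotheses: the complete plane `[a, a]` at angles `0, π` (directions `e₁, -e₁`) satisfies ANGULAR ORDER,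
(COLLINEAR) and (CLOSED) — for any `e₁, e₂` (orthonormality is not even needed for this). -/
theorem angular_axioms_pair (a : Fin 4) (e₁ e₂ : V) :
    (∀ i j : ℕ, i < j → j < ([a, a] : List (Fin 4)).length → (fun n : ℕ => (n : ℝ) * Real.pi) i < (fun n : ℕ => (n : ℝ) * Real.pi) j) ∧
    (∀ j : ℕ, j < ([a, a] : List (Fin 4)).length → (fun n : ℕ => (n : ℝ) * Real.pi) j < (fun n : ℕ => (n : ℝ) * Real.pi) 0 + 2 * Real.pi) ∧
    (∀ i j : ℕ, i < [a, a].length → j < [a, a].length → i ≠ j → faceNormal [a, a] i = faceNormal [a, a] j →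
      (fun n : ℕ => Real.cos ((n : ℝ) * Real.pi) • e₁ + Real.sin ((n : ℝ) * Real.pi) • e₂) j =
        (fun n : ℕ => Real.cos ((n : ℝ) * Real.pi) • e₁ + Real.sin ((n : ℝ) * Real.pi) • e₂) i ∨
      (fun n : ℕ => Real.cos ((n : ℝ) * Real.pi) • e₁ + Real.sin ((n : ℝ) * Real.pi) • e₂) j =
        -(fun n : ℕ => Real.cos ((n : ℝ) * Real.pi) • e₁ + Real.sin ((n : ℝ) * Real.pi) • e₂) i) ∧
    (([a, a] : List (Fin 4)).map twinRot).prod ∈ integralMatrices := by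
  refine ⟨?_, ?_, ?_, (sector_axioms_pair a e₁).2.2.2⟩
  · intro i j hij hj
    simp only [List.length_cons, List.length_nil] at hj
    have hi0 : i = 0 := by omega
    have hj1 : j = 1 := by omega
    subst hi0 hj1
    simp [Real.pi_pos]
  · intro j hj
    simp only [List.length_cons, List.length_nil] at hj
    have hj' : (j : ℝ) ≤ 1 := by exact_mod_cast (by omega : j ≤ 1)
    simp only [Nat.cast_zero, zero_mul, zero_add]
    nlinarith [Real.pi_pos]
  · intro i j hi hj hij _
    right
    simp only [List.length_cons, List.length_nil] at hi hj
    rcases Nat.lt_or_gt_of_ne hij with h | h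
    · have hi0 : i = 0 := by omega
      have hj1 : j = 1 := by omega
      subst hi0 hj1
      simp
    · have hj0 : j = 0 := by omega
      have hi1 : i = 1 := by omega
      subst hj0 hi1
      simp

end TwinSector

end Summit.AtomisticToContinuum.Crystallization.Theorems.ChargedEnergyGapChartDial

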